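import Summits.QuantumFields.YangMills.Theorems.BalabanUVNodesN15CovariantLandauFlatRowsAllScalesKing
import Summits.QuantumFields.YangMills.Theorems.BalabanUVNodesN15TwoSpacingGluingCurvedKnitCovariantLandauGlobalRowsFromDefect
import HarnessLib

/-!
# Route «BalabanUVNodes», node N15 = NE2, road (c) — THE FOURTEEN FLAT ROWS OF THE (G3) ROAD AT EVERY INDEX OF THE GLUED FAMILY, ONE CONSTANT BLOCK — the twelve flat kernel rows
# ((Ξ-5) `flatRowsAll_king'`) and the two `S(1)⁻¹` rows (n15-c∕222b `flatSopRow_ct_uniform`) read at the index `i : SfIdx d L` of the (P-R)∕(P-S) family (torus `cvM = 2L^{m+1}`, coarse run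
# `L^{kk}`, fine run `L^r·L^{kk}`, King's couplings `a_{kk}(1), a_{r+kk}(1) ∈ [1∕2, 1]`), the knit-ready input of the node edition 234′ (dag-n15-a g34, (Ξ-6))

Cell `pub-ymgap`, seat `pub-ymgap-dag-n15-a` (generation g34; KNIT-BY-NAME lane; HUMAN RULING D-0062; chair R424 venue).  `bears_on: R4∕N15 · K3⁸ SpineGivenEndpointR13SepCoPHV
(stmt-QuantumFields-27366)`; filed `--supports stmt-QuantumFields-27366 --as helper` — COUNT-NEUTRAL.  One theorem; 0 `sorry`; bookkeeping only.  Imports BY NAME (Ξ-5)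
`…CovariantLandauFlatRowsAllScalesKing` (★★★ `flatRowsAll_king'`), dag-n15-a (♭-8a) `…TwoSpacingGluingCurvedKnitCovariantLandauGlobalRowsFromDefect` (for the family's objects `SfIdx`,
`cvM` and n15-c∕222b `flatSopRow_ct_uniform`, `King1986.aK_ge ∕ aK_le ∕ aK_pos` — the pattern of `flatRows_two_grids`).  Nothing in the tree is modified; no estimate is proved here.

WHY.  n15-c∕240 `hasMaj_idef_landauCov_of_rows` (the two-grid η-defect of `D(I−R)Dᵀ(T)`) and its successors 241 ∕ 234′ display, per index `i` of the glued family, the flat inputs of the (G3)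
road: one-grid rows of `G′(1)`, `∂G′(1)`, `G′(1)∂ᵀ`, `S̄ₕ∂G′(1)`, `S(1)⁻¹` on both runs and the four flat two-grid kernel rows — at ONE decay rate.  THIS FILE is the package at the index:
★★★ `flatRowsAll_sfIdx` — for odd `L ≥ 7` (the family's standing `hL`, `hL7`) and `0 < γ < 1∕2`: `∃ C δ CS > 0 ∀ i : SfIdx d L`, at the masses `a_{kk} := aK 1 L i.kk·(L^{kk})^{d+1}`
(coarse) ∕ `a_{r+kk} := aK 1 L (i.r + i.kk)·(L^rL^{kk})^{d+1}` (fine), with `1∕2 ≤ aK 1 L · ≤ 1` (the mass windows of 219 ∕ 222b): rows 1–4 coarse one-grid, 5–8 fine one-grid (`C·e^{−δd}`),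
9–12 two-grid (`C·(L^{kk})^{−γ}·e^{−δd}`), 13–14 the `S(1)⁻¹` rows (`CS·n^{d+1}·e^{−δd}`), all in `unitTorusGeo L i.kk (cvM …)`, `d = tdistT`, every `i` (incl. `i.r = 0`).

HONEST FRAMING ∕ LIMITS.  Bookkeeping over (Ξ-5) and n15-c∕222b; King's `A = 0` MODEL rung (dag-n15-e) and the T⁴ cell's Combes–Thomas row behind; MODEL carriers of the glued family; NOT
[Balaban1985BackgroundPropagators] Thm 3.1 ∕ [Balaban1984PropagatorsII] Prop. 2.3 as printed; NE2⁺ NOT PRINTED; N15 of record untouched (DISCHARGED AS CONSUMED, p687738); counts UNMOVED (typed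
28∕28 · discharged 8∕27); one finite 𝕋⁴ at fixed ε per index — NOT infinite volume ∕ OS ∕ mass gap ∕ Clay.  Restate-immune (no Theses import).  No `sorry`, `instance`, `notation`; standard axioms.
-/

noncomputable section

open scoped BigOperators Matrix Kronecker

namespace Summit.QuantumFields.YangMills.BalabanUVNodes.N15.Gluing

open Literature.MathematicalPhysics.QuantumFieldTheory.Balaban1983to89
open Literature.MathematicalPhysics.QuantumFieldTheory.Balaban1983to89.B5Prop11Plancherel (Tor fine unitVec)
open Literature.MathematicalPhysics.QuantumFieldTheory.Balaban1983to89.B11SectG (BlockNorm HasMaj)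
open Literature.MathematicalPhysics.QuantumFieldTheory.Balaban1983to89.B6UnitTorusCarrier (unitTorusGeo)
open Literature.MathematicalPhysics.QuantumFieldTheory.Balaban1983to89.T4EtaRateDefect (idef)
open Literature.MathematicalPhysics.QuantumFieldTheory.Balaban1983to89.T4EtaRateCoeffDefect (pull)
open Literature.MathematicalPhysics.QuantumFieldTheory.King1986 (aK aK_pos aK_le aK_ge)
open Literature.MathematicalPhysics.QuantumFieldTheory.King1986.Torus (blockOf tdistT tdistT_nonneg)
open Summit.QuantumFields.YangMills.BalabanUVNodes.N15.VectorPiece (kingPr kingPrV)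
open Summit.QuantumFields.YangMills.BalabanUVNodes.N15.MatrixSpecies (liftBlk liftMap)
open Summit.QuantumFields.YangMills.BalabanUVNodes.N15.CovLandau (cgrad cGreen cSop bBack flatRowsAll_king' flatSopRow_ct_uniform)

variable (d : ℕ) {L : ℕ} [NeZero L] (ι : Type) [Fintype ι] [DecidableEq ι]

/-- ★★★ **THE FOURTEEN FLAT ROWS AT EVERY INDEX OF THE GLUED FAMILY, ONE CONSTANT BLOCK** (see the module docstring for the list; masses `aK 1 L i.kk·(L^{kk})^{d+1}` ∕ `aK 1 L (i.r+i.kk)·(L^rL^{kk})^{d+1}`,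
windows `1∕2 ≤ aK ≤ 1`).
[cite: King1986, Thm 3.3 p.655, (3.7)–(3.8) p.656, Prop. 3.8 (3.71) p.664, Prop. 3.9 (3.73) p.665, (2.16) p.653 (the couplings `a_k`), (4.5) p.670; Balaban1984PropagatorsII, Prop. 2.3 pp.230–231 (the `(QG²Q*)⁻¹` row: shape); Balaban1985BackgroundPropagators, Thm 3.1 (3.42)–(3.43) pp.397–398 (shapes at `U ≡ 1`)] -/
theorem flatRowsAll_sfIdx (hL : Odd L ∧ 1 < L) (hL7 : 7 ≤ L) {γ : ℝ} (hγ0 : 0 < γ) (hγ1 : γ < 1 / 2) :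
    ∃ C δ CS : ℝ, 0 < C ∧ 0 < δ ∧ 0 < CS ∧ ∀ i : SfIdx d L,
      ((1 / 2 : ℝ) ≤ aK 1 (L : ℝ) i.kk ∧ aK 1 (L : ℝ) i.kk ≤ 1 ∧ (1 / 2 : ℝ) ≤ aK 1 (L : ℝ) (i.r + i.kk) ∧ aK 1 (L : ℝ) (i.r + i.kk) ≤ 1) ∧
        HasMaj (BlockNorm.ofBlocks (unitTorusGeo L i.kk (cvM d L i.m i.kk hL)) (liftBlk (blockOf (L ^ i.kk) (cvM d L i.m i.kk hL)) ι)) (BlockNorm.ofBlocks (unitTorusGeo L i.kk (cvM d L i.m i.kk hL)) (liftBlk (blockOf (L ^ i.kk) (cvM d L i.m i.kk hL)) ι)) (Matrix.mulVecLin (cGreen (cvM d L i.m i.kk hL) (L ^ i.kk) (fun (_ : Fin (d + 1)) (_ : Tor (fine (L ^ i.kk) (cvM d L i.m i.kk hL))) => (1 : Matrix ι ι ℝ)) (aK 1 (L : ℝ) i.kk * (((L ^ i.kk) : ℕ) : ℝ) ^ (d + 1)))) (fun y y' => C * Real.exp (-(δ * tdistT (cvM d L i.m i.kk hL) y y')))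 ∧
        HasMaj (BlockNorm.ofBlocks (unitTorusGeo L i.kk (cvM d L i.m i.kk hL)) (liftBlk (blockOf (L ^ i.kk) (cvM d L i.m i.kk hL)) ι)) (BlockNorm.ofBlocks (unitTorusGeo L i.kk (cvM d L i.m i.kk hL)) (liftBlk (fun b : Tor (fine (L ^ i.kk) (cvM d L i.m i.kk hL)) × Fin (d + 1) => blockOf (L ^ i.kk) (cvM d L i.m i.kk hL) b.1) ι)) (Matrix.mulVecLin (cgrad (cvM d L i.m i.kk hL) (L ^ i.kk) (fun (_ : Fin (d + 1)) (_ : Tor (fine (L ^ i.kk) (cvM d L i.m i.kk hL))) => (1 : Matrix ι ι ℝ)) * cGreen (cvM d L i.m i.kk hL) (L ^ i.kk) (fun (_ : Fin (d + 1)) (_ : Tor (fine (L ^ i.kk) (cvM d L i.m i.kk hL))) => (1 : Matrix ι ι ℝ)) (aK 1 (L : ℝ) i.kk * (((L ^ i.kk) : ℕ) : ℝ) ^ (d + 1)))) (fun y y' => C * Real.exp (-(δ * tdistT (cvM d L i.m i.kk hL) y y'))) ∧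
        HasMaj (BlockNorm.ofBlocks (unitTorusGeo L i.kk (cvM d L i.m i.kk hL)) (liftBlk (fun b : Tor (fine (L ^ i.kk) (cvM d L i.m i.kk hL)) × Fin (d + 1) => blockOf (L ^ i.kk) (cvM d L i.m i.kk hL) b.1) ι)) (BlockNorm.ofBlocks (unitTorusGeo L i.kk (cvM d L i.m i.kk hL)) (liftBlk (blockOf (L ^ i.kk) (cvM d L i.m i.kk hL)) ι)) (Matrix.mulVecLin (cGreen (cvM d L i.m i.kk hL) (L ^ i.kk) (fun (_ : Fin (d + 1)) (_ : Tor (fine (L ^ i.kk) (cvM d L i.m i.kk hL))) => (1 : Matrix ι ι ℝ)) (aK 1 (L : ℝ) i.kk * (((L ^ i.kk) : ℕ) : ℝ) ^ (d + 1)) * (cgrad (cvM d L i.m i.kk hL) (L ^ i.kk) (fun (_ : Fin (d + 1)) (_ : Tor (fine (L ^ i.kk) (cvM d L i.m i.kk hL))) => (1 : Matrix ι ι ℝ)))ᵀ)) (fun y y' => C * Real.exp (-(δ * tdistT (cvM d L i.m i.kk hL) y y'))) ∧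
        HasMaj (BlockNorm.ofBlocks (unitTorusGeo L i.kk (cvM d L i.m i.kk hL)) (liftBlk (blockOf (L ^ i.kk) (cvM d L i.m i.kk hL)) ι)) (BlockNorm.ofBlocks (unitTorusGeo L i.kk (cvM d L i.m i.kk hL)) (liftBlk (fun b : Tor (fine (L ^ i.kk) (cvM d L i.m i.kk hL)) × Fin (d + 1) => blockOf (L ^ i.kk) (cvM d L i.m i.kk hL) b.1) ι)) (Matrix.mulVecLin ((bBack (cvM d L i.m i.kk hL) (L ^ i.kk) (ι := ι)) * ((cgrad (cvM d L i.m i.kk hL) (L ^ i.kk) (fun (_ : Fin (d + 1)) (_ : Tor (fine (L ^ i.kk) (cvM d L i.m i.kk hL))) => (1 : Matrix ι ι ℝ))) * (cGreen (cvM d L i.m i.kk hL) (L ^ i.kk) (fun (_ : Fin (d + 1)) (_ : Tor (fine (L ^ i.kk) (cvM d L i.m i.kk hL))) => (1 : Matrix ι ι ℝ)) (aK 1 (L : ℝ) i.kk * (((L ^ i.kk) : ℕ) : ℝ) ^ (d + 1)))))) (fun y y' => C * Real.exp (-(δ * tdistT (cvM d L i.m i.kk hL) y y'))) ∧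
        HasMaj (BlockNorm.ofBlocks (unitTorusGeo L i.kk (cvM d L i.m i.kk hL)) (liftBlk (blockOf (L ^ i.r * L ^ i.kk) (cvM d L i.m i.kk hL)) ι)) (BlockNorm.ofBlocks (unitTorusGeo L i.kk (cvM d L i.m i.kk hL)) (liftBlk (blockOf (L ^ i.r * L ^ i.kk) (cvM d L i.m i.kk hL)) ι)) (Matrix.mulVecLin (cGreen (cvM d L i.m i.kk hL) (L ^ i.r * L ^ i.kk) (fun (_ : Fin (d + 1)) (_ : Tor (fine (L ^ i.r * L ^ i.kk) (cvM d L i.m i.kk hL))) => (1 : Matrix ι ι ℝ)) (aK 1 (L : ℝ) (i.r + i.kk) * (((L ^ i.r * L ^ i.kk) : ℕ) : ℝ) ^ (d + 1)))) (fun y y' => C * Real.exp (-(δ * tdistT (cvM d L i.m i.kk hL) y y'))) ∧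
        HasMaj (BlockNorm.ofBlocks (unitTorusGeo L i.kk (cvM d L i.m i.kk hL)) (liftBlk (blockOf (L ^ i.r * L ^ i.kk) (cvM d L i.m i.kk hL)) ι)) (BlockNorm.ofBlocks (unitTorusGeo L i.kk (cvM d L i.m i.kk hL)) (liftBlk (fun b : Tor (fine (L ^ i.r * L ^ i.kk) (cvM d L i.m i.kk hL)) × Fin (d + 1) => blockOf (L ^ i.r * L ^ i.kk) (cvM d L i.m i.kk hL) b.1) ι)) (Matrix.mulVecLin (cgrad (cvM d L i.m i.kk hL) (L ^ i.r * L ^ i.kk) (fun (_ : Fin (d + 1)) (_ : Tor (fine (L ^ i.r * L ^ i.kk) (cvM d L i.m i.kk hL))) => (1 : Matrix ι ι ℝ)) * cGreen (cvM d L i.m i.kk hL) (L ^ i.r * L ^ i.kk) (fun (_ : Fin (d + 1)) (_ : Tor (fine (L ^ i.r * L ^ i.kk) (cvM d L i.m i.kk hL))) => (1 : Matrix ι ι ℝ)) (aK 1 (L : ℝ) (i.r + i.kk) * (((L ^ i.r * L ^ i.kk) : ℕ) : ℝ) ^ (d + 1)))) (fun y y' => C * Real.exp (-(δ * tdistT (cvM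 d L i.m i.kk hL) y y'))) ∧
        HasMaj (BlockNorm.ofBlocks (unitTorusGeo L i.kk (cvM d L i.m i.kk hL)) (liftBlk (fun b : Tor (fine (L ^ i.r * L ^ i.kk) (cvM d L i.m i.kk hL)) × Fin (d + 1) => blockOf (L ^ i.r * L ^ i.kk) (cvM d L i.m i.kk hL) b.1) ι)) (BlockNorm.ofBlocks (unitTorusGeo L i.kk (cvM d L i.m i.kk hL)) (liftBlk (blockOf (L ^ i.r * L ^ i.kk) (cvM d L i.m i.kk hL)) ι)) (Matrix.mulVecLin (cGreen (cvM d L i.m i.kk hL) (L ^ i.r * L ^ i.kk) (fun (_ : Fin (d + 1)) (_ : Tor (fine (L ^ i.r * L ^ i.kk) (cvM d L i.m i.kk hL))) => (1 : Matrix ι ι ℝ)) (aK 1 (L : ℝ) (i.r + i.kk) * (((L ^ i.r * L ^ i.kk) : ℕ) : ℝ) ^ (d + 1)) * (cgrad (cvM d L i.m i.kk hL) (L ^ i.r * L ^ i.kk) (fun (_ : Fin (d + 1)) (_ : Tor (fine (L ^ i.r * L ^ i.kk) (cvM d L i.m i.kk hL))) => (1 : Matrix ι ι ℝ)))ᵀ))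 (fun y y' => C * Real.exp (-(δ * tdistT (cvM d L i.m i.kk hL) y y'))) ∧
        HasMaj (BlockNorm.ofBlocks (unitTorusGeo L i.kk (cvM d L i.m i.kk hL)) (liftBlk (blockOf (L ^ i.r * L ^ i.kk) (cvM d L i.m i.kk hL)) ι)) (BlockNorm.ofBlocks (unitTorusGeo L i.kk (cvM d L i.m i.kk hL)) (liftBlk (fun b : Tor (fine (L ^ i.r * L ^ i.kk) (cvM d L i.m i.kk hL)) × Fin (d + 1) => blockOf (L ^ i.r * L ^ i.kk) (cvM d L i.m i.kk hL) b.1) ι)) (Matrix.mulVecLin ((bBack (cvM d L i.m i.kk hL) (L ^ i.r * L ^ i.kk) (ι := ι)) * ((cgrad (cvM d L i.m i.kk hL) (L ^ i.r * L ^ i.kk) (fun (_ : Fin (d + 1)) (_ : Tor (fine (L ^ i.r * L ^ i.kk) (cvM d L i.m i.kk hL))) => (1 : Matrix ι ι ℝ))) * (cGreen (cvM d L i.m i.kk hL) (L ^ i.r * L ^ i.kk) (fun (_ : Fin (d + 1)) (_ : Tor (fine (L ^ i.r * L ^ i.kk) (cvM d L i.m i.kk hL))) => (1 : Matrix ι ι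 ℝ)) (aK 1 (L : ℝ) (i.r + i.kk) * (((L ^ i.r * L ^ i.kk) : ℕ) : ℝ) ^ (d + 1)))))) (fun y y' => C * Real.exp (-(δ * tdistT (cvM d L i.m i.kk hL) y y'))) ∧
        HasMaj (BlockNorm.ofBlocks (unitTorusGeo L i.kk (cvM d L i.m i.kk hL)) (liftBlk (blockOf (L ^ i.kk) (cvM d L i.m i.kk hL)) ι)) (BlockNorm.ofBlocks (unitTorusGeo L i.kk (cvM d L i.m i.kk hL)) (liftBlk (blockOf (L ^ i.r * L ^ i.kk) (cvM d L i.m i.kk hL)) ι)) (idef (pull (liftMap (kingPr L i.kk i.r (cvM d L i.m i.kk hL)) ι)) (pull (liftMap (kingPr L i.kk i.r (cvM d L i.m i.kk hL)) ι)) (Matrix.mulVecLin (cGreen (cvM d L i.m i.kk hL) (L ^ i.r * L ^ i.kk) (fun (_ : Fin (d + 1)) (_ : Tor (fine (L ^ i.r * L ^ i.kk) (cvM d L i.m i.kk hL))) => (1 : Matrix ι ι ℝ)) (aK 1 (L : ℝ) (i.r + i.kk) * (((L ^ i.r * L ^ i.kk) : ℕ) : ℝ) ^ (d + 1)))) (Matrix.mulVecLin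 (cGreen (cvM d L i.m i.kk hL) (L ^ i.kk) (fun (_ : Fin (d + 1)) (_ : Tor (fine (L ^ i.kk) (cvM d L i.m i.kk hL))) => (1 : Matrix ι ι ℝ)) (aK 1 (L : ℝ) i.kk * (((L ^ i.kk) : ℕ) : ℝ) ^ (d + 1))))) (fun y y' => C * ((L : ℝ) ^ i.kk) ^ (-γ) * Real.exp (-(δ * tdistT (cvM d L i.m i.kk hL) y y'))) ∧
        HasMaj (BlockNorm.ofBlocks (unitTorusGeo L i.kk (cvM d L i.m i.kk hL)) (liftBlk (blockOf (L ^ i.kk) (cvM d L i.m i.kk hL)) ι)) (BlockNorm.ofBlocks (unitTorusGeo L i.kk (cvM d L i.m i.kk hL)) (liftBlk (fun b : Tor (fine (L ^ i.r * L ^ i.kk) (cvM d L i.m i.kk hL)) × Fin (d + 1) => blockOf (L ^ i.r * L ^ i.kk) (cvM d L i.m i.kk hL) b.1) ι)) (idef (pull (liftMap (kingPr L i.kk i.r (cvM d L i.m i.kk hL)) ι)) (pull (liftMap (kingPrV L i.kk i.r (cvM d L i.m i.kk hL)) ι)) (Matrix.mulVecLin (cgrad (cvM d L i.m i.kk hL)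 (L ^ i.r * L ^ i.kk) (fun (_ : Fin (d + 1)) (_ : Tor (fine (L ^ i.r * L ^ i.kk) (cvM d L i.m i.kk hL))) => (1 : Matrix ι ι ℝ)) * cGreen (cvM d L i.m i.kk hL) (L ^ i.r * L ^ i.kk) (fun (_ : Fin (d + 1)) (_ : Tor (fine (L ^ i.r * L ^ i.kk) (cvM d L i.m i.kk hL))) => (1 : Matrix ι ι ℝ)) (aK 1 (L : ℝ) (i.r + i.kk) * (((L ^ i.r * L ^ i.kk) : ℕ) : ℝ) ^ (d + 1)))) (Matrix.mulVecLin (cgrad (cvM d L i.m i.kk hL) (L ^ i.kk) (fun (_ : Fin (d + 1)) (_ : Tor (fine (L ^ i.kk) (cvM d L i.m i.kk hL))) => (1 : Matrix ι ι ℝ)) * cGreen (cvM d L i.m i.kk hL) (L ^ i.kk) (fun (_ : Fin (d + 1)) (_ : Tor (fine (L ^ i.kk) (cvM d L i.m i.kk hL))) => (1 : Matrix ι ι ℝ)) (aK 1 (L : ℝ) i.kk * (((L ^ i.kk) : ℕ) : ℝ) ^ (d + 1))))) (fun y y' => C * ((L : ℝ) ^ i.kk) ^ (-γ) * Real.exp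 (-(δ * tdistT (cvM d L i.m i.kk hL) y y'))) ∧
        HasMaj (BlockNorm.ofBlocks (unitTorusGeo L i.kk (cvM d L i.m i.kk hL)) (liftBlk (fun b : Tor (fine (L ^ i.kk) (cvM d L i.m i.kk hL)) × Fin (d + 1) => blockOf (L ^ i.kk) (cvM d L i.m i.kk hL) b.1) ι)) (BlockNorm.ofBlocks (unitTorusGeo L i.kk (cvM d L i.m i.kk hL)) (liftBlk (blockOf (L ^ i.r * L ^ i.kk) (cvM d L i.m i.kk hL)) ι)) (idef (pull (liftMap (kingPrV L i.kk i.r (cvM d L i.m i.kk hL)) ι)) (pull (liftMap (kingPr L i.kk i.r (cvM d L i.m i.kk hL)) ι)) (Matrix.mulVecLin (cGreen (cvM d L i.m i.kk hL) (L ^ i.r * L ^ i.kk) (fun (_ : Fin (d + 1)) (_ : Tor (fine (L ^ i.r * L ^ i.kk) (cvM d L i.m i.kk hL))) => (1 : Matrix ι ι ℝ)) (aK 1 (L : ℝ) (i.r + i.kk) * (((L ^ i.r * L ^ i.kk) : ℕ) : ℝ) ^ (d + 1)) * (cgrad (cvM d L i.m i.kk hL) (L ^ i.r * L ^ i.kk)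 (fun (_ : Fin (d + 1)) (_ : Tor (fine (L ^ i.r * L ^ i.kk) (cvM d L i.m i.kk hL))) => (1 : Matrix ι ι ℝ)))ᵀ)) (Matrix.mulVecLin (cGreen (cvM d L i.m i.kk hL) (L ^ i.kk) (fun (_ : Fin (d + 1)) (_ : Tor (fine (L ^ i.kk) (cvM d L i.m i.kk hL))) => (1 : Matrix ι ι ℝ)) (aK 1 (L : ℝ) i.kk * (((L ^ i.kk) : ℕ) : ℝ) ^ (d + 1)) * (cgrad (cvM d L i.m i.kk hL) (L ^ i.kk) (fun (_ : Fin (d + 1)) (_ : Tor (fine (L ^ i.kk) (cvM d L i.m i.kk hL))) => (1 : Matrix ι ι ℝ)))ᵀ))) (fun y y' => C * ((L : ℝ) ^ i.kk) ^ (-γ) * Real.exp (-(δ * tdistT (cvM d L i.m i.kk hL) y y'))) ∧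
        HasMaj (BlockNorm.ofBlocks (unitTorusGeo L i.kk (cvM d L i.m i.kk hL)) (liftBlk (blockOf (L ^ i.kk) (cvM d L i.m i.kk hL)) ι)) (BlockNorm.ofBlocks (unitTorusGeo L i.kk (cvM d L i.m i.kk hL)) (liftBlk (fun b : Tor (fine (L ^ i.r * L ^ i.kk) (cvM d L i.m i.kk hL)) × Fin (d + 1) => blockOf (L ^ i.r * L ^ i.kk) (cvM d L i.m i.kk hL) b.1) ι)) (idef (pull (liftMap (kingPr L i.kk i.r (cvM d L i.m i.kk hL)) ι)) (pull (liftMap (kingPrV L i.kk i.r (cvM d L i.m i.kk hL)) ι)) (Matrix.mulVecLin ((bBack (cvM d L i.m i.kk hL) (L ^ i.r * L ^ i.kk) (ι := ι)) * ((cgrad (cvM d L i.m i.kk hL) (L ^ i.r * L ^ i.kk) (fun (_ : Fin (d + 1)) (_ : Tor (fine (L ^ i.r * L ^ i.kk) (cvM d L i.m i.kk hL))) => (1 : Matrix ι ι ℝ))) * (cGreen (cvM d L i.m i.kk hL) (L ^ i.r * L ^ i.kk) (fun (_ : Fin (d + 1)) (_ : Tor (fine (L ^ i.r * L ^ i.kk)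 (cvM d L i.m i.kk hL))) => (1 : Matrix ι ι ℝ)) (aK 1 (L : ℝ) (i.r + i.kk) * (((L ^ i.r * L ^ i.kk) : ℕ) : ℝ) ^ (d + 1)))))) (Matrix.mulVecLin ((bBack (cvM d L i.m i.kk hL) (L ^ i.kk) (ι := ι)) * ((cgrad (cvM d L i.m i.kk hL) (L ^ i.kk) (fun (_ : Fin (d + 1)) (_ : Tor (fine (L ^ i.kk) (cvM d L i.m i.kk hL))) => (1 : Matrix ι ι ℝ))) * (cGreen (cvM d L i.m i.kk hL) (L ^ i.kk) (fun (_ : Fin (d + 1)) (_ : Tor (fine (L ^ i.kk) (cvM d L i.m i.kk hL))) => (1 : Matrix ι ι ℝ)) (aK 1 (L : ℝ) i.kk * (((L ^ i.kk) : ℕ) : ℝ) ^ (d + 1))))))) (fun y y' => C * ((L : ℝ) ^ i.kk) ^ (-γ) * Real.exp (-(δ * tdistT (cvM d L i.m i.kk hL) y y'))) ∧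
        HasMaj (BlockNorm.ofBlocks (unitTorusGeo L i.kk (cvM d L i.m i.kk hL)) (liftBlk (fun y : Tor (cvM d L i.m i.kk hL) => y) ι)) (BlockNorm.ofBlocks (unitTorusGeo L i.kk (cvM d L i.m i.kk hL)) (liftBlk (fun y : Tor (cvM d L i.m i.kk hL) => y) ι)) (Matrix.mulVecLin (cSop (cvM d L i.m i.kk hL) (L ^ i.kk) (fun (_ : Fin (d + 1)) (_ : Tor (fine (L ^ i.kk) (cvM d L i.m i.kk hL))) => (1 : Matrix ι ι ℝ)) (aK 1 (L : ℝ) i.kk * (((L ^ i.kk) : ℕ) : ℝ) ^ (d + 1)))⁻¹) (fun y y' => CS * (((L ^ i.kk) : ℕ) : ℝ) ^ (d + 1) * Real.exp (-(δ * tdistT (cvM d L i.m i.kk hL) y y'))) ∧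
        HasMaj (BlockNorm.ofBlocks (unitTorusGeo L i.kk (cvM d L i.m i.kk hL)) (liftBlk (fun y : Tor (cvM d L i.m i.kk hL) => y) ι)) (BlockNorm.ofBlocks (unitTorusGeo L i.kk (cvM d L i.m i.kk hL)) (liftBlk (fun y : Tor (cvM d L i.m i.kk hL) => y) ι)) (Matrix.mulVecLin (cSop (cvM d L i.m i.kk hL) (L ^ i.r * L ^ i.kk) (fun (_ : Fin (d + 1)) (_ : Tor (fine (L ^ i.r * L ^ i.kk) (cvM d L i.m i.kk hL))) => (1 : Matrix ι ι ℝ)) (aK 1 (L : ℝ) (i.r + i.kk) * (((L ^ i.r * L ^ i.kk) : ℕ) : ℝ) ^ (d + 1)))⁻¹) (fun y y' => CS * (((L ^ i.r * L ^ i.kk) : ℕ) : ℝ) ^ (d + 1) * Real.exp (-(δ * tdistT (cvM d L i.m i.kk hL) y y'))) := by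
  have hL2 : 2 ≤ L := le_trans (by norm_num) hL7
  have hL1r : (1 : ℝ) < (L : ℝ) := by exact_mod_cast hL.2
  obtain ⟨C, δ, hC, hδ, H⟩ := flatRowsAll_king' (d := d) L hL.1 hL2 (a₀ := (1 : ℝ)) one_pos hγ0 hγ1
  obtain ⟨CS, δS, hCS, hδS, HS⟩ := flatSopRow_ct_uniform (d := d) L (a₁ := (1 / 2 : ℝ)) (a₂ := (1 : ℝ)) (by norm_num) (by norm_num)
  -- King's couplings lie in `[1/2, 1]`
  have haKlo : ∀ K : ℕ, 1 ≤ K → (1 / 2 : ℝ) ≤ aK 1 (L : ℝ) K := fun K hK => by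
    have h1 := aK_ge one_pos hL1r hK (a := (1 : ℝ))
    have hL2r : (2 : ℝ) ≤ (L : ℝ) := by exact_mod_cast hL2
    have hL4 : (4 : ℝ) ≤ (L : ℝ) ^ 2 := by nlinarith
    have hinv : ((L : ℝ) ^ 2)⁻¹ ≤ 1 / 4 := by rw [one_div]; exact inv_anti₀ (by norm_num) hL4
    linarith
  refine ⟨C, min δ δS, CS, hC, lt_min hδ hδS, hCS, fun i => ?_⟩
  have hK1 : 1 ≤ i.kk := i.one_le
  have hK2 : 1 ≤ i.r + i.kk := hK1.trans (Nat.le_add_left _ _)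
  have hMc : ∀ μ, cvM d L i.m i.kk hL μ = 2 * L ^ (i.m + 1) := fun μ => rfl
  obtain ⟨r1, r2, r3, r4, r5, r6, r7, r8, r9, r10, r11, r12⟩ := H i.kk hK1 i.r (i.m + 1) (cvM d L i.m i.kk hL) hMc ι
  have hSc := HS (aK 1 (L : ℝ) i.kk) (haKlo i.kk hK1) (aK_le one_pos hL1r hK1) (cvM d L i.m i.kk hL) (L ^ i.kk) i.kk ι
  have hSf := HS (aK 1 (L : ℝ) (i.r + i.kk)) (haKlo (i.r + i.kk) hK2) (aK_le one_pos hL1r hK2) (cvM d L i.m i.kk hL) (L ^ i.r * L ^ i.kk) i.kk ι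
  -- weaken every rate to `min δ δS`
  have hθ : 0 ≤ ((L : ℝ) ^ i.kk) ^ (-γ) := Real.rpow_nonneg (pow_nonneg (Nat.cast_nonneg L) _) _
  have hm : ∀ (c δ' : ℝ) (y y' : Tor (cvM d L i.m i.kk hL)), 0 ≤ c → min δ δS ≤ δ' →
      c * Real.exp (-(δ' * tdistT (cvM d L i.m i.kk hL) y y')) ≤ c * Real.exp (-(min δ δS * tdistT (cvM d L i.m i.kk hL) y y')) :=
    fun c δ' y y' hc hδ' => mul_le_mul_of_nonneg_left (Real.exp_le_exp.mpr (by nlinarith [tdistT_nonneg (cvM d L i.m i.kk hL) y y'])) hc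
  have hCθ : 0 ≤ C * ((L : ℝ) ^ i.kk) ^ (-γ) := mul_nonneg hC.le hθ
  have hNc : (0 : ℝ) ≤ CS * ((L ^ i.kk : ℕ) : ℝ) ^ (d + 1) := by positivity
  have hNf : (0 : ℝ) ≤ CS * ((L ^ i.r * L ^ i.kk : ℕ) : ℝ) ^ (d + 1) := by positivity
  have e1 : min δ δS ≤ δ := min_le_left _ _
  have e2 : min δ δS ≤ δS := min_le_right _ _
  exact ⟨⟨haKlo i.kk hK1, aK_le one_pos hL1r hK1, haKlo (i.r + i.kk) hK2, aK_le one_pos hL1r hK2⟩,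
    r1.mono fun y y' => hm C δ y y' hC.le e1, r2.mono fun y y' => hm C δ y y' hC.le e1, r3.mono fun y y' => hm C δ y y' hC.le e1, r4.mono fun y y' => hm C δ y y' hC.le e1,
    r5.mono fun y y' => hm C δ y y' hC.le e1, r6.mono fun y y' => hm C δ y y' hC.le e1, r7.mono fun y y' => hm C δ y y' hC.le e1, r8.mono fun y y' => hm C δ y y' hC.le e1,
    r9.mono fun y y' => hm _ δ y y' hCθ e1, r10.mono fun y y' => hm _ δ y y' hCθ e1, r11.mono fun y y' => hm _ δ y y' hCθ e1, r12.mono fun y y' => hm _ δ y y' hCθ e1,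
    hSc.mono fun y y' => hm _ δS y y' hNc e2, hSf.mono fun y y' => hm _ δS y y' hNf e2⟩

end Summit.QuantumFields.YangMills.BalabanUVNodes.N15.Gluing

end
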